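import Summits.BirchSwinnertonDyer.BirchSwinnertonDyer.Theses.UniversalToricDescent
import Summits.BirchSwinnertonDyer.BirchSwinnertonDyer.Theorems.UniversalToricDescentTwinAlgMuZeroAtThreeOfBetaRoadParam
import Summits.BirchSwinnertonDyer.BirchSwinnertonDyer.Theorems.UniversalToricDescentBetaRoadParamDefs
import Summits.BirchSwinnertonDyer.BirchSwinnertonDyer.Theorems.UniversalToricDescentTwinAlgMuZeroAtThreeGoodOrd
import Summits.BirchSwinnertonDyer.BirchSwinnertonDyer.Theorems.UniversalToricDescentTwinSplitIMCAtThreeSupsetGoodSS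
import Literature.NumberTheory.EllipticCurves.CastellaCiperianiSkinnerSprung2018.AnticyclotomicHowardDivisibilityOPEN
import HarnessLib

/-!
# NODE `signed-howard-half` on `UniversalToricDescent.TwinAlgMuZeroAtThree` (stmt-BirchSwinnertonDyer-24737, crux r205)
# — crux-ideate STANDING COVER gen 2 (unit `cruxidea-stmt-BirchSwinnertonDyer-24737-1-g2`), UNREGISTERED (the LEAD's
# registered line is `Lines/beta_road.lean` v19; this node re-uses its two bucket-B stubs BY NAME and replaces ONLY the
# opaque C₀′ stub by a typed, glued decomposition of the good-supersingular bucket).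

THE C₀ NODE.  `beta_road` v19 carries bucket C₀ (good supersingular `a₃ = 0` twins, 603 classes) as ONE opaque research
stub `stub_goodSS : …BetaRoadParamDefs.TwinAlgMuZeroAtThreeGoodSSOfParam` («signed frame — a different line, planners»).
This node types that line in the currency the tree already has and PROVES the glue:

* `stub_howardHalfTorsionGoodSSApZero` (S_C, RESEARCH — the ONE research input of bucket C₀ on this road): at every C₀′
  datum `(W′, N′, K, Dt′, κ, γ, 𝔭, 𝔭′)` and every `ι′` inducing `𝔭`, `X_(∅,0)(E′/K_∞^ac)` (strict at `𝔭′`) is `Λ`-torsion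
  AND some BDP frame `L` of `f_{W′}` at `(ι′, 𝔭)` lies in `Ch_Λ(X_(∅,0))·R₀⟦T⟧` (the Kolyvagin / Howard direction `⊇` at ONE
  frame, WITH torsion — without torsion the membership is vacuous, `charIdeal_eq_top_of_not_isTorsion`).  CERTIFIED
  below (`stubC_of_ccssOPEN`, sorry-free) to be the `p = 3`, `a₃ = 0`, `d_K` odd INSTANCE of the tree's labelled OPEN
  claim `CastellaCiperianiSkinnerSprung2018.thm57_lemma55_exists_isBDPLFunction_isTorsion_mem_charIdeal_OPEN` (signed
  `♯/♭` Heegner-class Kolyvagin system + signed explicit reciprocity law + Lemma 5.5 length transfer, standing `p > 2`,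
  `N⁻ = 1` allowed; UNREFEREED — the refereed Castella–Wan 2024 Thm. 5.12/§6.1 has standing `p > 3`, `p ∤ 6N_fD_K`), via the
  landed `…TwinSplit.exists_howardFrame_isTorsion_of_goodSS_of_ccss` (p-landed, seat utd-p2).  Its frame conjunct is,
  binder for binder, the REGISTERED stub `stub_howardFrameSS_apZero` of line `threeframes-apzero` on the sibling crux
  stmt-BirchSwinnertonDyer-23594 `TwinSplitIMCAtThreeGoodSSApZero` (readback `…GoodSSApZeroHalves.howardHalf_of_…`): the
  two cruxes SHARE this research leaf.
* `stub_printBcsMuZero` (PRINT, refereed; NOT research): the route's own aside item stmt-BirchSwinnertonDyer-20790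
  `BCSMuZeroInput` = Burungale–Castella–Skinner 2025 Prop. 4.2.2 (a BDP frame with `μ = 0` for every curve of GOOD
  reduction at an odd `p`, no ordinarity; = Hsieh 2014 Thm. B).  BOOKKEEPING FLAG F-PRINT: the crux 24737 hands NO print
  binder to its C₀ branch, so on ANY `L`-function road C₀′ closes only as `BCSMuZeroInput → C₀′`; at route level this is
  the pattern already used for 20400 (`TwinMuZeroAtThreeOfThmB`, displayed binder `hThmB` of `closes`) — LEAD / tenure:
  either restate C₀′ ↦ `BCSMuZeroInput → C₀′` (count-neutral, WEAKER stub) and thread item 20790 through `closes`, or keep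
  C₀′ print-free (then only (β)-type roads — `Ideas/height-two-newton-signed-beta.md` — qualify).
* `twinAlgMuGoodSSOfParam_of_howardHalfTorsion_of_bcsMu` (GLUE, sorry-free): S_C → `BCSMuZeroInput` → C₀′ — the bucket-A
  proof `…TwinAlgMu.twinAlgMu_of_goodOrd_of_bcs` (p709524) moved to bucket C₀: `Ch_Λ` is principal
  (`charIdeal_isPrincipal_holds`), the Howard frame gives `⊇` at EVERY frame (`crux_conjunct_one_and_supset_forall_frame_of_howardFrame`,
  p543791), so the generator divides the `μ = 0` frame of Prop. 4.2.2 (`exists_frame_mu_eq_zero_of_good`), and a divisor of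
  a `μ = 0` series has `μ = 0` (`exists_norm_coeff_eq_one_of_dvd`).
* `TwinAlgMuZeroAtThree_of` concludes the crux BY NAME through the LEAD's landed composition
  `…OfBetaRoadParam.twinAlgMuZeroAtThree_of_betaRoadParamStubs` (K1‴ → K2a‴ → C₀′ → crux).

`lean check`: sorries ONLY in the four `stub_*` (3 research: K1‴, K2a‴ BY NAME from `beta_road` v19, S_C; 1 print: 20790).
BSD is proved for no curve by this file; 24737 / 32864 / 23594 stay OPEN.  Card: `Lines/signed_howard_half.md`.
-/

noncomputable section

open scoped Classical NumberField

set_option linter.dupNamespace false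
set_option autoImplicit false

namespace Summit.BirchSwinnertonDyer.BirchSwinnertonDyer.Cruxes.TwinAlgMuZeroAtThree.SignedHowardHalf

open PowerSeries WeierstrassCurve NumberField IsDedekindDomain Field
  Literature.NumberTheory.EllipticCurves
  Literature.NumberTheory.EllipticCurves.ModularForms
  Literature.NumberTheory.EllipticCurves.Rank1Residual
  Literature.NumberTheory.GaloisRepresentations
  Literature.NumberTheory.EllipticCurves.IwasawaAlgebra
  Literature.NumberTheory.EllipticCurves.ZpExtension
  Summit.BirchSwinnertonDyer.Rank1Residual
  Summit.BirchSwinnertonDyer.Rank1Residual.X11b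
  Summit.BirchSwinnertonDyer.Rank1Residual.X11b.Halves
  Summit.BirchSwinnertonDyer.BirchSwinnertonDyer.Theorems
  Summit.BirchSwinnertonDyer.BirchSwinnertonDyer.Theorems.SchneiderFree
  Summit.BirchSwinnertonDyer.BirchSwinnertonDyer.Theorems.UniversalToricDescentNormProfile
  Summit.BirchSwinnertonDyer.BirchSwinnertonDyer.Theorems.UniversalToricDescentTwinSplit
  Summit.BirchSwinnertonDyer.BirchSwinnertonDyer.Theorems.UniversalToricDescentTwinAlgMu
  Summit.BirchSwinnertonDyer.BirchSwinnertonDyer.Theses.UniversalToricDescent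

/-! ## 1. The stubs -/

/-- **stub_principalHeegnerIndivisibleMult** (K1‴, bucket B, RESEARCH) — BY NAME, the LEAD's registered stub of
`beta_road` v19 (`…BetaRoadParamDefs.PrincipalHeegnerIndivisibleMultOfParamAtThree`); untouched by this node.
[cite: Castella2024, §2.2 and Thm. 2.1] [cite: BertoliniDarmon1996, §2.5] -/
theorem stub_principalHeegnerIndivisibleMult :
    UniversalToricDescentBetaRoadParamDefs.PrincipalHeegnerIndivisibleMultOfParamAtThree := by
  sorry

/-- **stub_ksTwinLambda** (K2a‴, bucket B, RESEARCH) — BY NAME, the promoted UTD item stmt-BirchSwinnertonDyer-32864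
(`…Theses.UniversalToricDescent.KsTwinLambdaAdicAtThree`); untouched by this node.
[cite: Howard2004HeegnerKolyvagin, Thm. 2.3.1] [cite: CastellaGrossiLeeSkinner2022, Thm. 4.1.1, Rem. 4.1.4] -/
theorem stub_ksTwinLambda :
    Summit.BirchSwinnertonDyer.BirchSwinnertonDyer.Theses.UniversalToricDescent.KsTwinLambdaAdicAtThree := by
  sorry

/-- **stub_howardHalfTorsionGoodSSApZero** (S_C, bucket C₀, RESEARCH — the Kolyvagin/Howard direction WITH torsion, at
ONE BDP frame, for every good-supersingular `a₃ = 0` twin datum of C₀′ and every `ι′` inducing `𝔭`).  = the `p = 3`,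
`a₃ = 0`, `d_K` odd instance of the tree's OPEN claim `CastellaCiperianiSkinnerSprung2018.thm57_lemma55_…_OPEN`
(`stubC_of_ccssOPEN` below); its frame conjunct = the registered `stub_howardFrameSS_apZero` of line `threeframes-apzero`
on crux 23594.  Mechanism in print (p odd, unrefereed): signed Λ-adic Heegner classes `ℨ^{♯/♭}` (CÇSS18 Thm. 4.6),
signed explicit reciprocity law `Log^∙(res_𝔭 ℨ^∙) = 𝓛_𝔭^BDP` (Thm. 4.7), Kolyvagin-system divisibility
`c²·Char(𝔛^{∙,∙}_tors) ⊇ Char(Sel^{∙,∙}/Λℨ_c^∙)²` with `Λ`-rank one (Thm. 5.7, hypothesis: `ρ̄|G_K` irreducible), and the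
length transfer to `𝔛^{rel,str}` at every height-one prime INCLUDING `𝔓 = 3Λ` (Lemma 5.5).
[cite: CastellaCiperianiSkinnerSprung2018, Thm. 4.6, Thm. 4.7, Prop. 5.6, Thm. 5.7, Lemma 5.5 (arXiv:1804.10993v2 pp. 17, 22–23)]
[cite: CastellaWan2016, Thm. 5.12, Thm. 6.1 proof (arXiv:1607.02019v? pp. 21, 23) (refereed, p > 3)] -/
theorem stub_howardHalfTorsionGoodSSApZero :
    ∀ (W' : WeierstrassCurve ℚ) [W'.IsElliptic] [W'.IsGloballyMinimal] (N' : ℕ) [NeZero N']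
      (K : Type) [Field K] [NumberField K] (Dt' : ModularParametrizationData W' N'),
      GoodSS W' 3 → W'.frobeniusTrace 3 = 0 → W'.HasSurjectiveModNGaloisRep 3 → W'.conductorNorm ℤ = N' →
      IsImaginaryQuadratic K → SatisfiesHeegnerHypothesis N' K → Odd (NumberField.discr K) →
      ∀ (κ : ZpExtension K 3), κ.IsAnticyclotomic → ∀ (γ : absoluteGaloisGroup K) [Fact (κ.IsTopGenerator γ)]
        (𝔭 : HeightOneSpectrum (𝓞 K)), ((3 : ℕ) : 𝓞 K) ∈ 𝔭.asIdeal →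
        𝔭.asIdeal.ramificationIdx (𝓞 ℚ) = 1 → 𝔭.asIdeal.inertiaDeg (𝓞 ℚ) = 1 →
        ∀ (𝔭' : HeightOneSpectrum (𝓞 K)), ((3 : ℕ) : 𝓞 K) ∈ 𝔭'.asIdeal → 𝔭' ≠ 𝔭 →
        ∀ (ι' : PadicAlgCl 3 ≃+* ℂ), BranchInducesPrime 3 ι' 𝔭 →
        Module.IsTorsion (IwasawaAlgebra 3) (AcSelmer.XAc (W'.baseChange K) 3 κ 𝔭' ∅ γ) ∧
        ∃ (ΩK : ℂ) (Ωp : ℂ_[3]) (L : UnrSeries 3), ΩK ≠ 0 ∧ Ωp ≠ 0 ∧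
          IsBDPLFunction ι' 𝔭 κ γ Dt'.f ΩK Ωp L ∧
          L ∈ (AcSelmer.XAc.charIdeal (W'.baseChange K) 3 κ 𝔭' ∅ γ).map (PowerSeries.map (toUnr 3)) := by
  sorry

/-- **stub_printBcsMuZero** (PRINT INPUT, refereed — NOT research): the route's aside item stmt-BirchSwinnertonDyer-20790
`BCSMuZeroInput` = Burungale–Castella–Skinner 2025 Prop. 4.2.2 (⟸ Hsieh 2014 Thm. B).  Carried as a `sorry` ONLY so that
`TwinAlgMuZeroAtThree_of` has the crux's literal type; see flag F-PRINT in the header and the print-displayed composition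
`TwinAlgMuZeroAtThree_of_print` below. [cite: BurungaleCastellaSkinner2025, Prop. 4.2.2 (§4.2, pp. 8–9 of arXiv:2405.00270v2)]
[cite: Hsieh2014, Thm. B] -/
theorem stub_printBcsMuZero : BCSMuZeroInput := by
  sorry

/-! ## 2. S_C is the `p = 3`, `a₃ = 0` instance of the tree's CÇSS18 open claim (certificate, sorry-free) -/

/-- **S_C ⟸ the labelled OPEN claim `thm57_lemma55_…_OPEN`** (its `p = 3` instances at good-supersingular `a₃ = 0` twins;
`a₃ = 0`, the conductor clause and `d_K` odd are not even used): one call of the landed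
`…TwinSplit.exists_howardFrame_isTorsion_of_goodSS_of_ccss`.  CONDITIONAL on `hC` (unrefereed preprint).
[cite: CastellaCiperianiSkinnerSprung2018, Thm. 5.7, Lemma 5.5, proof of Thm. 5.8 (arXiv:1804.10993v2 §5.1)] -/
theorem stubC_of_ccssOPEN
    (hC : CastellaCiperianiSkinnerSprung2018.thm57_lemma55_exists_isBDPLFunction_isTorsion_mem_charIdeal_OPEN) :
    ∀ (W' : WeierstrassCurve ℚ) [W'.IsElliptic] [W'.IsGloballyMinimal] (N' : ℕ) [NeZero N']
      (K : Type) [Field K] [NumberField K] (Dt' : ModularParametrizationData W' N'),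
      GoodSS W' 3 → W'.frobeniusTrace 3 = 0 → W'.HasSurjectiveModNGaloisRep 3 → W'.conductorNorm ℤ = N' →
      IsImaginaryQuadratic K → SatisfiesHeegnerHypothesis N' K → Odd (NumberField.discr K) →
      ∀ (κ : ZpExtension K 3), κ.IsAnticyclotomic → ∀ (γ : absoluteGaloisGroup K) [Fact (κ.IsTopGenerator γ)]
        (𝔭 : HeightOneSpectrum (𝓞 K)), ((3 : ℕ) : 𝓞 K) ∈ 𝔭.asIdeal →
        𝔭.asIdeal.ramificationIdx (𝓞 ℚ) = 1 → 𝔭.asIdeal.inertiaDeg (𝓞 ℚ) = 1 →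
        ∀ (𝔭' : HeightOneSpectrum (𝓞 K)), ((3 : ℕ) : 𝓞 K) ∈ 𝔭'.asIdeal → 𝔭' ≠ 𝔭 →
        ∀ (ι' : PadicAlgCl 3 ≃+* ℂ), BranchInducesPrime 3 ι' 𝔭 →
        Module.IsTorsion (IwasawaAlgebra 3) (AcSelmer.XAc (W'.baseChange K) 3 κ 𝔭' ∅ γ) ∧
        ∃ (ΩK : ℂ) (Ωp : ℂ_[3]) (L : UnrSeries 3), ΩK ≠ 0 ∧ Ωp ≠ 0 ∧
          IsBDPLFunction ι' 𝔭 κ γ Dt'.f ΩK Ωp L ∧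
          L ∈ (AcSelmer.XAc.charIdeal (W'.baseChange K) 3 κ 𝔭' ∅ γ).map (PowerSeries.map (toUnr 3)) := by
  intro W' _ _ N' _ K _ _ Dt' hss _ha hsurj _hN hK hH _hodd κ hκ γ _ 𝔭 h𝔭 he hf 𝔭' h𝔭' hne ι' hι'
  exact exists_howardFrame_isTorsion_of_goodSS_of_ccss hC W' N' K Dt' hss hsurj hK hH κ hκ γ 𝔭 h𝔭 he hf
    𝔭' h𝔭' hne ι' hι'

/-! ## 3. The glue: S_C → print → C₀′ (sorry-free) -/

/-- **Bucket C₀′ pointwise from ONE Howard frame with torsion and ONE `μ = 0` frame** — the bucket-A argument of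
`…TwinAlgMu.twinAlgMu_of_goodOrd_of_bcs` verbatim at a good-SUPERSINGULAR twin: `Ch_Λ(X_(∅,0))` is principal, the Howard
frame propagates to `⊇` at every frame across periods, so the generator divides the `μ = 0` frame of Prop. 4.2.2, and a
divisor of a `μ = 0` series has `μ = 0`.  CONDITIONAL on `h422` (refereed print).
[cite: BurungaleCastellaSkinner2025, Prop. 4.2.2 (§4.2, pp. 8–9 of arXiv:2405.00270v2)]
[cite: Washington1997, §13.2 (characteristic ideals of Λ-modules are principal)] -/
theorem twinAlgMuGoodSS_pointwise_of_howardFrameTorsion_of_bcsMu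
    (h422 : BurungaleCastellaSkinner2025.prop422_exists_isBDPLFunction_mu_eq_zero)
    (W' : WeierstrassCurve ℚ) [W'.IsElliptic] [W'.IsGloballyMinimal] (N' : ℕ) [NeZero N']
    (K : Type) [Field K] [NumberField K] (Dt' : ModularParametrizationData W' N')
    (hss : GoodSS W' 3) (hsurj : W'.HasSurjectiveModNGaloisRep 3)
    (hK : IsImaginaryQuadratic K) (hH : SatisfiesHeegnerHypothesis N' K)
    (hodd : Odd (NumberField.discr K))
    (κ : ZpExtension K 3) (hκ : κ.IsAnticyclotomic) (γ : absoluteGaloisGroup K)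
    [Fact (κ.IsTopGenerator γ)]
    (𝔭 : HeightOneSpectrum (𝓞 K)) (h𝔭 : ((3 : ℕ) : 𝓞 K) ∈ 𝔭.asIdeal)
    (he : 𝔭.asIdeal.ramificationIdx (𝓞 ℚ) = 1) (hf : 𝔭.asIdeal.inertiaDeg (𝓞 ℚ) = 1)
    (𝔭' : HeightOneSpectrum (𝓞 K)) (_h𝔭' : ((3 : ℕ) : 𝓞 K) ∈ 𝔭'.asIdeal) (_hne : 𝔭' ≠ 𝔭)
    (ι' : PadicAlgCl 3 ≃+* ℂ) (hι' : BranchInducesPrime 3 ι' 𝔭)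
    (htors : Module.IsTorsion (IwasawaAlgebra 3) (AcSelmer.XAc (W'.baseChange K) 3 κ 𝔭' ∅ γ))
    (hHow : ∃ (ΩK : ℂ) (Ωp : ℂ_[3]) (L : UnrSeries 3), ΩK ≠ 0 ∧ Ωp ≠ 0 ∧
      IsBDPLFunction ι' 𝔭 κ γ Dt'.f ΩK Ωp L ∧
      L ∈ (AcSelmer.XAc.charIdeal (W'.baseChange K) 3 κ 𝔭' ∅ γ).map (PowerSeries.map (toUnr 3))) :
    Module.IsTorsion (IwasawaAlgebra 3) (AcSelmer.XAc (W'.baseChange K) 3 κ 𝔭' ∅ γ) ∧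
      ∃ g' : UnrSeries 3,
        (AcSelmer.XAc.charIdeal (W'.baseChange K) 3 κ 𝔭' ∅ γ).map (PowerSeries.map (toUnr 3)) =
          Ideal.span {g'} ∧
        ∃ i : ℕ, ‖((PowerSeries.coeff i g' : unrIntegers 3) : ℂ_[3])‖ = 1 := by
  have hd3 : NumberField.discr K ≠ -3 := discr_ne_neg_three_of_degreeOne hK h𝔭 he hf
  -- `⊇` at EVERY frame from the one Howard frame (periods are rigid up to units)
  obtain ⟨-, hsupAll⟩ :=
    crux_conjunct_one_and_supset_forall_frame_of_howardFrame W' N' K Dt' κ γ 𝔭 𝔭' ι' hK hκ hHow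
  refine ⟨htors, ?_⟩
  -- `Ch_Λ(X_ac)` is principal, so its extension to `R₀⟦T⟧` is generated by the image of a generator
  obtain ⟨F, hF⟩ :=
    (charIdeal_isPrincipal_holds 3 (AcSelmer.XAc (W'.baseChange K) 3 κ 𝔭' ∅ γ)).principal
  have hchar : AcSelmer.XAc.charIdeal (W'.baseChange K) 3 κ 𝔭' ∅ γ = Ideal.span {F} := hF
  refine ⟨PowerSeries.map (toUnr 3) F, by rw [hchar, map_span_singleton_eq], ?_⟩
  -- the `μ = 0` frame of Prop 4.2.2 (good reduction suffices)
  obtain ⟨ΩK₃, Ωp₃, L₃, hΩK₃, hL₃, hμ⟩ := exists_frame_mu_eq_zero_of_good h422 W' N' K Dt' hss.1 hsurj hK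
    hH hodd hd3 κ hκ γ 𝔭 h𝔭 he hf ι' hι'
  have hΩp₃ : ((Ωp₃ : unrIntegers 3) : ℂ_[3]) ≠ 0 := by
    intro h0
    have h1 := norm_coe_units_unrIntegers 3 Ωp₃
    rw [h0, norm_zero] at h1
    exact zero_ne_one h1
  have hsup : Ideal.span {L₃} ≤
      (AcSelmer.XAc.charIdeal (W'.baseChange K) 3 κ 𝔭' ∅ γ).map (PowerSeries.map (toUnr 3)) :=
    hsupAll ΩK₃ _ L₃ hΩK₃ hΩp₃ hL₃
  rw [hchar, map_span_singleton_eq, Ideal.span_singleton_le_span_singleton] at hsup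
  exact exists_norm_coeff_eq_one_of_dvd hsup (exists_norm_coeff_eq_one_of_exists_isUnit hμ)

/-- **THE GLUE OF THE NODE: C₀′ ⟸ S_C ∧ print** (`BCSMuZeroInput` = item 20790).  Sorry-free given its two hypotheses.
[cite: BurungaleCastellaSkinner2025, Prop. 4.2.2 (§4.2, pp. 8–9 of arXiv:2405.00270v2)] -/
theorem twinAlgMuGoodSSOfParam_of_howardHalfTorsion_of_bcsMu
    (hS : ∀ (W' : WeierstrassCurve ℚ) [W'.IsElliptic] [W'.IsGloballyMinimal] (N' : ℕ) [NeZero N']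
      (K : Type) [Field K] [NumberField K] (Dt' : ModularParametrizationData W' N'),
      GoodSS W' 3 → W'.frobeniusTrace 3 = 0 → W'.HasSurjectiveModNGaloisRep 3 → W'.conductorNorm ℤ = N' →
      IsImaginaryQuadratic K → SatisfiesHeegnerHypothesis N' K → Odd (NumberField.discr K) →
      ∀ (κ : ZpExtension K 3), κ.IsAnticyclotomic → ∀ (γ : absoluteGaloisGroup K) [Fact (κ.IsTopGenerator γ)]
        (𝔭 : HeightOneSpectrum (𝓞 K)), ((3 : ℕ) : 𝓞 K) ∈ 𝔭.asIdeal →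
        𝔭.asIdeal.ramificationIdx (𝓞 ℚ) = 1 → 𝔭.asIdeal.inertiaDeg (𝓞 ℚ) = 1 →
        ∀ (𝔭' : HeightOneSpectrum (𝓞 K)), ((3 : ℕ) : 𝓞 K) ∈ 𝔭'.asIdeal → 𝔭' ≠ 𝔭 →
        ∀ (ι' : PadicAlgCl 3 ≃+* ℂ), BranchInducesPrime 3 ι' 𝔭 →
        Module.IsTorsion (IwasawaAlgebra 3) (AcSelmer.XAc (W'.baseChange K) 3 κ 𝔭' ∅ γ) ∧
        ∃ (ΩK : ℂ) (Ωp : ℂ_[3]) (L : UnrSeries 3), ΩK ≠ 0 ∧ Ωp ≠ 0 ∧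
          IsBDPLFunction ι' 𝔭 κ γ Dt'.f ΩK Ωp L ∧
          L ∈ (AcSelmer.XAc.charIdeal (W'.baseChange K) 3 κ 𝔭' ∅ γ).map (PowerSeries.map (toUnr 3)))
    (h422 : BCSMuZeroInput) :
    UniversalToricDescentBetaRoadParamDefs.TwinAlgMuZeroAtThreeGoodSSOfParam := by
  refine UniversalToricDescentBetaRoadParamDefs.twinAlgMuZeroAtThreeGoodSSOfParam_iff.mpr ?_
  intro W' _ _ N' _ K _ _ Dt' hss ha hsurj hN hK hH hodd κ hκ γ _ 𝔭 h𝔭 he hf 𝔭' h𝔭' hne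
  obtain ⟨ι', hι'⟩ := exists_branchInducesPrime 3 hK h𝔭
  obtain ⟨htors, hHow⟩ := hS W' N' K Dt' hss ha hsurj hN hK hH hodd κ hκ γ 𝔭 h𝔭 he hf 𝔭' h𝔭' hne ι' hι'
  exact twinAlgMuGoodSS_pointwise_of_howardFrameTorsion_of_bcsMu h422 W' N' K Dt' hss hsurj hK hH hodd κ hκ γ
    𝔭 h𝔭 he hf 𝔭' h𝔭' hne ι' hι' htors hHow

/-- **C₀′ ⟸ the CÇSS18 open claim ∧ BCS 2025 Prop. 4.2.2** — bucket C₀ of crux 24737 is CLOSED MODULO one labelled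
OPEN preprint claim at `p = 3` and one refereed fact (the honest status of the bucket on every `L`-function road).
[cite: CastellaCiperianiSkinnerSprung2018, Thm. 5.7, Lemma 5.5 (arXiv:1804.10993v2 §5.1)]
[cite: BurungaleCastellaSkinner2025, Prop. 4.2.2 (§4.2, pp. 8–9 of arXiv:2405.00270v2)] -/
theorem twinAlgMuGoodSSOfParam_of_ccssOPEN_of_bcsMu
    (hC : CastellaCiperianiSkinnerSprung2018.thm57_lemma55_exists_isBDPLFunction_isTorsion_mem_charIdeal_OPEN)
    (h422 : BCSMuZeroInput) :
    UniversalToricDescentBetaRoadParamDefs.TwinAlgMuZeroAtThreeGoodSSOfParam :=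
  twinAlgMuGoodSSOfParam_of_howardHalfTorsion_of_bcsMu (stubC_of_ccssOPEN hC) h422

/-! ## 4. The compositions -/

/-- **Print-displayed composition**: with the print input `BCSMuZeroInput` (item 20790) as an explicit binder, the three
RESEARCH stubs (K1‴, K2a‴ of `beta_road` v19 and S_C) give the crux BY NAME.  Sorry-free as a term; the `sorry`s are the
three research stubs it is applied to in `TwinAlgMuZeroAtThree_of`. [cite: Howard2004HeegnerKolyvagin, Thm. 2.3.1, Thm. B (shape)] -/
theorem TwinAlgMuZeroAtThree_of_print (h422 : BCSMuZeroInput)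
    (hK1 : UniversalToricDescentBetaRoadParamDefs.PrincipalHeegnerIndivisibleMultOfParamAtThree)
    (hK2 : Summit.BirchSwinnertonDyer.BirchSwinnertonDyer.Theses.UniversalToricDescent.KsTwinLambdaAdicAtThree)
    (hS : ∀ (W' : WeierstrassCurve ℚ) [W'.IsElliptic] [W'.IsGloballyMinimal] (N' : ℕ) [NeZero N']
      (K : Type) [Field K] [NumberField K] (Dt' : ModularParametrizationData W' N'),
      GoodSS W' 3 → W'.frobeniusTrace 3 = 0 → W'.HasSurjectiveModNGaloisRep 3 → W'.conductorNorm ℤ = N' →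
      IsImaginaryQuadratic K → SatisfiesHeegnerHypothesis N' K → Odd (NumberField.discr K) →
      ∀ (κ : ZpExtension K 3), κ.IsAnticyclotomic → ∀ (γ : absoluteGaloisGroup K) [Fact (κ.IsTopGenerator γ)]
        (𝔭 : HeightOneSpectrum (𝓞 K)), ((3 : ℕ) : 𝓞 K) ∈ 𝔭.asIdeal →
        𝔭.asIdeal.ramificationIdx (𝓞 ℚ) = 1 → 𝔭.asIdeal.inertiaDeg (𝓞 ℚ) = 1 →
        ∀ (𝔭' : HeightOneSpectrum (𝓞 K)), ((3 : ℕ) : 𝓞 K) ∈ 𝔭'.asIdeal → 𝔭' ≠ 𝔭 →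
        ∀ (ι' : PadicAlgCl 3 ≃+* ℂ), BranchInducesPrime 3 ι' 𝔭 →
        Module.IsTorsion (IwasawaAlgebra 3) (AcSelmer.XAc (W'.baseChange K) 3 κ 𝔭' ∅ γ) ∧
        ∃ (ΩK : ℂ) (Ωp : ℂ_[3]) (L : UnrSeries 3), ΩK ≠ 0 ∧ Ωp ≠ 0 ∧
          IsBDPLFunction ι' 𝔭 κ γ Dt'.f ΩK Ωp L ∧
          L ∈ (AcSelmer.XAc.charIdeal (W'.baseChange K) 3 κ 𝔭' ∅ γ).map (PowerSeries.map (toUnr 3))) :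
    Summit.BirchSwinnertonDyer.BirchSwinnertonDyer.Theses.UniversalToricDescent.TwinAlgMuZeroAtThree :=
  UniversalToricDescentTwinAlgMuZeroAtThreeOfBetaRoadParam.twinAlgMuZeroAtThree_of_betaRoadParamStubs hK1
    (by simpa only [Summit.BirchSwinnertonDyer.BirchSwinnertonDyer.Theses.UniversalToricDescent.KsTwinLambdaAdicAtThree]
      using hK2)
    (twinAlgMuGoodSSOfParam_of_howardHalfTorsion_of_bcsMu hS h422)

/-- **The composition**: concludes the crux `…Theses.UniversalToricDescent.TwinAlgMuZeroAtThree` BY NAME from the four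
stubs (three research, one print). -/
theorem TwinAlgMuZeroAtThree_of :
    Summit.BirchSwinnertonDyer.BirchSwinnertonDyer.Theses.UniversalToricDescent.TwinAlgMuZeroAtThree :=
  TwinAlgMuZeroAtThree_of_print stub_printBcsMuZero stub_principalHeegnerIndivisibleMult stub_ksTwinLambda
    stub_howardHalfTorsionGoodSSApZero

end Summit.BirchSwinnertonDyer.BirchSwinnertonDyer.Cruxes.TwinAlgMuZeroAtThree.SignedHowardHalf

end
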